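import Mathlib
import HarnessLib
import HarnessLib.Audit
import Summits.QuantumFields.Statement
import Literature.Barriers.QuantumFields.FiniteTemperatureDeconfinement
import Literature.MathematicalPhysics.QuantumLattice.LatticeGaugeDLR
import HarnessLib.Audit.Status.Attr

/-!
Route: ThermalRuler

DORMANT since 2026-08-23T07:19:09Z (reconciler: no traction for 6 d (last activity item-evidence-added at 2026-08-17T07:23:30Z); parked, not closed — `ledger route dormant route-QuantumFields-ThermalRuler --off` to reactivate) — unstaffed, not closed; items shared with open routes are served there. `ledger route dormant <id> --off` reactivates.

# Route ThermalRuler — Deconfinement is a ruler — Borgs–Seiler's linear thermal window against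
quantitative Chatterjee forces xi_strong(beta) >~ beta^(1/4); IR-first assembly with the scale set
by the mixing length

X = THERMAL RULER BOUND (card thermal-ruler-deconfinement-bounds-mixing-length, K1 ∧ K3 ∧ P1 of the
card folded into one
inequality): for every compact connected (second-countable) group G, every continuous unitary matrix
representation ρ of G and
every central z with ρ(z) = ω·1, ω ≠ 1, there are C, a such that for all β ≥ 2: if four-dimensional
Wilson lattice gauge theory
in the representation ρ at coupling β has EXPONENTIAL DECAY OF CORRELATIONS UNDER ARBITRARY BOUNDARY
CONDITIONS (Chatterjee2021
Def. 2.3: covariances of edge-local functions bounded by 1 in every cube with every boundary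
condition are ≤ K₁e^(−K₂·dist),
2 ≤ K₁, 0 < K₂ ≤ 1), then K₂⁴·β ≤ C·log(βK₁/K₂)^a — i.e. either strong decay fails outright at β, or
the strong mixing length
1/K₂ is ≥ c(β/polylog)^(1/4). Mechanism: Borgs–Seiler deconfine the thermal lattice ℤ³×ℤ_L₀ for β ≥
C(G,ρ)·L₀ (LINEAR window,
from the explicit rate f(J) = (1+2χ(1)/J)^L₀ − 1 of BorgsSeiler1983 Lemma III.6), while a
quantitative form of Chatterjee2021
Thm 2.4, run in FINITE volume (condition the periodic box on its time-zero slice; the centre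
transform is an exact symmetry of
the slab measure with fixed temporal faces, so ⟨χ(P_x)⟩ = 0 slab-wise, and his slab coupling
decorrelates P_0 from P_x), kills
Polyakov long-range order as soon as L₀ ≥ A·K₂^(−4)·polylog. "It suffices to show X" in the
following honest sense: X discharges,
with a RATE and for every G whose chosen representation sees the centre, the softening leg (lattice
mixing length → ∞ along
the scheme, hence a_k → 0 when the spacing is set by the mixing length) of the IR-first assembly
StrongGapSeqAllG →
SofteningCentreBlind → ContinuumFromMixing → YangMills; the ruler never produces a gap or a
continuum limit.
Lean: `∀ (G : Type) [Group G] [TopologicalSpace G] [IsTopologicalGroup G] [CompactSpace G]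
[SecondCountableTopology G] [MeasurableSpace G] [BorelSpace G] [ConnectedSpace G] (n : ℕ) (ρ : G →*
Matrix (Fin n) (Fin n) ℂ) (z : G) (ω : ℂ), 0 < n → Continuous ρ → (∀ g, ρ g ∈ Matrix.unitaryGroup
(Fin n) ℂ) → (∀ g : G, z * g = g * z) → ω ≠ 1 → ρ z = ω • (1 : Matrix (Fin n) (Fin n) ℂ) → ∃ C : ℝ,
∃ a : ℕ, 0 < C ∧ ∀ (β K₁ K₂ : ℝ), 2 ≤ β → 2 ≤ K₁ → 0 < K₂ → K₂ ≤ 1 → (∀ (M : ℕ) (v : Fin 4 → ℤ) (Λ :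
Finset (Literature.MathematicalPhysics.QuantumLattice.ZdEdge 4)) (η :
Literature.MathematicalPhysics.QuantumLattice.LGConfig 4 G) (e₁ e₂ :
Literature.MathematicalPhysics.QuantumLattice.ZdEdge 4) (f g :
Literature.MathematicalPhysics.QuantumLattice.LGConfig 4 G → ℝ), Λ = (((Fintype.piFinset fun j : Fin
4 => Finset.Icc (v j) (v j + M)) ×ˢ (Finset.univ : Finset (Fin 4))).filter fun e => e.1 e.2 + 1 ≤ v
e.2 + M ∧ ∀ j, j ≠ e.2 → v j < e.1 j ∧ e.1 j < v j + M) → (∀ j, v j ≤ e₁.1 j ∧ e₁.1 j ≤ v j + M) →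
e₁.1 e₁.2 + 1 ≤ v e₁.2 + M → (∀ j, v j ≤ e₂.1 j ∧ e₂.1 j ≤ v j + M) → e₂.1 e₂.2 + 1 ≤ v e₂.2 + M →
Measurable f → Measurable g → Literature.MathematicalPhysics.QuantumLattice.IsCylinder f
((Literature.MathematicalPhysics.QuantumLattice.plaquettesTouching {e₁}).biUnion
Literature.MathematicalPhysics.QuantumLattice.plaquetteEdges) →
Literature.MathematicalPhysics.QuantumLattice.IsCylinder g
((Literature.MathematicalPhysics.QuantumLattice.plaquettesTouching {e₂}).biUnion
Literature.MathematicalPhysics.QuantumLattice.plaquetteEdges) → (∀ U, |f U| ≤ 1) → (∀ U, |g U| ≤ 1)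
→ |(∫ U, f U * g U ∂(Literature.MathematicalPhysics.QuantumLattice.ymSpecification (d := 4) ρ β Λ
η)) - (∫ U, f U ∂(Literature.MathematicalPhysics.QuantumLattice.ymSpecification (d := 4) ρ β Λ η)) *
(∫ U, g U ∂(Literature.MathematicalPhysics.QuantumLattice.ymSpecification (d := 4) ρ β Λ η))| ≤ K₁ *
Real.exp (-(K₂ * ‖e₁.1 - e₂.1‖))) → K₂ ^ 4 * β ≤ C * Real.log (β * K₁ / K₂) ^ a`

## Assembly
Pure logic (sorry-free in the planner's Sketch.lean, axioms propext/choice/Quot.sound): fix a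
compact simple Lie G; StrongGapSeqAllG
gives a faithful r with strong decay along b_k → ∞; case split (classical) on whether some central z
acts in r by a scalar ω ≠ 1:
if yes, ThermalRulerBound via RulerSoftens gives softening of the rates; if no, SofteningCentreBlind
does; ContinuumFromMixing then
yields the Clay clause for (G, r), i.e. the body of `YangMills` at G (same `letI := borel G`
instances). RulerFromCruxes closes
the loop from cruxes 2–3 to the target; TorusToStrong is the (unassembled) bridge to the torus
quantity of `HasLatticeMassGap`.

Rationale: WHY THIS LINE. Two printed theorems point in opposite directions along the temporal extent L₀ and
nobody has run them against each other:
BorgsSeiler1983 (Lemma III.6, Cor. III.7, Thm III.7, read pp. 344–354 of the held copy: infrared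
bound with
f(J_E) = (1 + 2χ(1)/J_E)^L₀ − 1, hence Polyakov long-range order for J_E ≳ χ(1)·L₀) and
Chatterjee2021 (Def. 2.3, Thm 2.4,
Lemmas 7.1–11.1 read: strong decay ⇒ slab uniqueness at thickness N ≥ N₀ ⇒ unbroken centre symmetry;
his Lemma 7.1 shows
C₂ = K₂ and C₁ ∝ βK₁, and re-optimising the block radius r ≍ (N/4C₃)^(1/d) in Lemma 11.1 gives N₀ ≤
A·K₂^(−d)·polylog).
The contrapositive turns the finite-temperature BARRIER (tree:
Literature.Barriers.QuantumFields.FiniteTemperatureDeconfinement)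
into a measuring stick for the zero-temperature strong mixing length — reflection positivity
(infrared bounds, Fröhlich–Israel–
Lieb–Simon double commutators) plus the centre, no expansion, no free-energy asymptotics, no
perturbation theory; imported areas:
Gaussian-domination/infrared-bound technology of statistical mechanics and Dobrushin-type coupling
(ChatterjeeYMProb2019 Problem 5.1
asks exactly for ξ(β) → ∞, open). What it does that prior cards/routes do not: the first RATE at
which a 4D non-abelian mixing
length must diverge (the thermodynamic cards give ξ → ∞ with no rate), entirely in finite volume on
the tree's
`FiniteTemperature.*` vocabulary (its rank-2 item LinearDeconfinementWindow — BS83 Thm III.7 with a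
LINEAR threshold J_E ≥ C₀(G,ρ,d)·L₀ — is a
strengthening of the catalogued cone fact
`Literature.Barriers.QuantumFields.FiniteTemperatureDeconfinement` (needs-fact) and is discharged by
the same BS83 §III.2 formalisation as `BorgsSeilerInfraredBound`); cruxes 5–7 are the shared
IR-first legs (mass-renormalised scheme a_k := m_k/Δ) every
lattice-first card needs, filed here so the assembly is pure logic — they parallel, in STRONG-mixing
form, the torus-form legs
LatticeGapLargeBeta / CriticalContinuumLimit of the sibling route EquipartitionCriticality opened
today, and TorusToStrong (crux 4) is
precisely the bridge between the two IR vocabularies; the negatives index is empty.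

RANKED CRUXES. #0 ThermalRulerBound (target) — the thermal ruler bound X above: for (G, ρ, z, ω)
with ρ continuous unitary, z central, ρ z = ω•1, ω ≠ 1, 0 < n: ∃ C a, ∀ β ≥ 2, ∀ K₁ ≥ 2, ∀ K₂ ∈
(0,1], StrongExpDecay(ρ, β, K₁, K₂) [inlined: all cubes v+[0,M]⁴ of ℤ⁴, all boundary conditions η
via `QuantumLattice.ymSpecification ρ β (interior edges) η`, all measurable edge-local f, g
(supports = plaquette-neighbourhoods of edges of the cube) with |f|,|g| ≤ 1: |E fg − Ef·Eg| ≤ K₁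
exp(−K₂·‖e₁.1 − e₂.1‖), sup-distance of base points] → K₂⁴·β ≤ C·(log(βK₁/K₂))^a. (why it might
fail: the rate survives only if Chatterjee's N₀ is polynomial in 1/K₂ (crux 3) and Borgs–Seiler's
window is linear in L₀ (crux 2); at large β SU(N) may simply sit in the first branch (strong decay
false for boundary-layer reasons), making X true but idle.) [BorgsSeiler1983, Chatterjee2021,
ChatterjeeYMProb2019]
#2 LinearDeconfinementWindow (support, rank 2; rev-3 position-side restatement of
ExplicitInfraredBound) — BORGS–SEILER DECONFINEMENT WITH A LINEAR WINDOW (BorgsSeiler1983 Thm III.7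
p. 353, inverting Lemma III.6's printed rate f(J_E) = (1 + 2J_E⁻¹χ(1))^L₀ − 1, p. 348): for every
compact second-countable G, every continuous unitary ρ : G → M_n(ℂ) with 0 < n and every space
dimension d ≥ 3 there is C₀ = C₀(G, ρ, d) > 0 such that for EVERY temporal extent L₀ ≥ 1 and all
couplings J_E ≥ C₀·L₀, J_M > 0 the tree predicate `FiniteTemperature.HasPolyakovLongRangeOrder d L₀
ρ J_E J_M` holds — Polyakov long-range order on ℤ^d×ℤ_L₀ in the linear window the ruler consumes (d
= 3, J_E = J_M = β); stated over the BASE module …FiniteTemperatureDeconfinement only. It FOLLOWS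
from the rev-2 Fourier-side statement (`HasPolyakovInfraredBound d L₀ ρ (A((1+A/J)^L₀ − 1))`) by the
PROVED `FiniteTemperature.hasPolyakovLongRangeOrder_of_infraredBound` +
`one_le_polyakovCorrelation_zero` + real arithmetic (planner folder Equiv.lean `window_of_explicit`,
lean check rc 0, axioms propext/choice/Quot.sound — the restatement does not strengthen the bet),
and it IMPLIES the catalogued fact `FiniteTemperatureDeconfinement` outright (Sketch.lean
`fact_of_window`). [difficulty: L] (why it might fail: the printed proof embeds G in ℂ^(n²) via ρ
(pp. 350–353) and is stated for U(N)/SU(N); a hidden L₀-dependence of the constants in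
(III.57)–(III.59) (digits illegible in the held scan) would make the window super-linear (J₀ ≫ L₀)
and shorten the ruler to log β.) [BorgsSeiler1983, FrohlichIsraelLiebSimon1978,
FrohlichSimonSpencer1976]
#3 QuantCentreRestoration (crux) — QUANTITATIVE CHATTERJEE IN THE PERIODIC BOX (card K1 + P1, finite
volume): for (G, ρ, z, ω) as in the target (G connected) there are A, a such that for β ≥ 2, K₁ ≥ 2,
K₂ ∈ (0,1]: StrongExpDecay(ρ, β, K₁, K₂) ⇒ for every temporal extent L₀ with A·(log(βK₁/K₂))^a ≤
K₂⁴·L₀ the isotropic finite-temperature theory (J_E = J_M = β, d = 3 space dimensions) has NO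
Polyakov long-range order, `¬ FiniteTemperature.HasPolyakovLongRangeOrder 3 L₀ ρ β β`. Intended
proof: Chatterjee2021 Lemmas 7.1–11.1 with explicit constants (C₂ = K₂, C₁ ∝ βK₁·n, block radius r ≍
(N/4C₃)^(1/4) instead of (log N)²) give a coupling of the slab of thickness N = L₀ with two boundary
conditions agreeing on the temporal faces whose disagreement probability decays like exp(−c·dist/N);
condition the periodic box ℤ_L₀×(ℤ/L)³ on its time-zero spatial links (Fubini on the finite product
Haar space): the slab measure with top = bottom = η is EXACTLY invariant under the centre transform,
so E_η[χ(P_x)] = ω·E_η[χ(P_x)] = 0, and the coupling gives |E_η[χ(P_0)χ̄(P_x)]| ≤ 2n²e^(−c‖x‖/L₀)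
uniformly in η and L; hence every thermodynamic limit of G_L tends to 0 (limits exist:
`exists_isThermodynamicLimit`). [difficulty: XL] (why it might fail: the global-update coupling pays
N^(2d−2)·r^(d−1) entropy per step; if the r-optimisation cannot beat it the threshold becomes
exp(c/K₂) (rate lost, ξ_s → ∞ survives as log β); periodic space and d = 3+1 bookkeeping of his
free-boundary slabs must be redone.) [Chatterjee2021, arXiv:2006.16229, BorgsSeiler1983]
#4 TorusToStrong (crux) — FROM TORUS TO STRONG MIXING (card K2 — the bridge from the ruler's
quantity to the Statement's `HasLatticeMassGap` torus quantity): for every compact second-countable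
G and continuous unitary ρ there is C > 0 such that for β ≥ 1, K ≥ 2, m > 0: if on EVERY symmetric
torus of side 2S+1 (tree `wilsonMeasure (d := 4) (L := 2S+1) ρ β`, observables pulled back by
`torusLift`) edge-local f, g bounded by 1 at torus distance ≤ S satisfy |E fg − Ef·Eg| ≤
K·exp(−m·dist), then StrongExpDecay(ρ, β, C·K·β, m/C) holds (cubes with arbitrary boundary
conditions). With the target: volume-uniform torus clustering at rate m at coupling β forces m⁴β ≤
C'·polylog, i.e. the torus rate of any `HasLatticeMassGap` witness closes at least like
β_k^(−1/4+o(1)). [difficulty: XL] (why it might fail: in d ≥ 3 weak mixing does not imply strong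
mixing (MartinelliOlivieri1994: boundary conditions can order a layer); for gauge theories boundary
holonomies impose fluxes/large fields whose screening is itself confinement physics, so the loss C
may have to grow with β.) [MartinelliOlivieri1994, doi:10.1007/bf02101930, Chatterjee2021]
#5 ContinuumFromMixing (crux) — THE UV/OS LEG OF THE IR-FIRST ASSEMBLY, SHARP FORM (shared by every
lattice-first card; this route does not attack it; restated 2026-08-16 for the re-typed Statement
p116790 — weak-coupling conjunct `sch.HasWeakCouplingLimit` — folding in the refuters' sharpness
repair of rev 4, rattack-10416 / g43-3): for every compact simple Lie group G, faithful unitary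
lattice representation r and couplings b_k → ∞, IF Wilson's theory in r has strong exponential decay
along b (K₁ = 4, some admissible rates m_k ∈ (0,1]) AND EVERY admissible rate sequence along b tends
to 0 (the SHARP strong rate softens — exactly the output shape of RulerSoftens /
SofteningCentreBlind; rev 4's ‘∃ rates with m_k → 0’ was idle because the inlined bound
4·exp(−m_k·dist) is antitone in m_k, which left the ruler logically idle in `closes`), THEN the
re-typed Clay clause holds for (G, r): a sequential WEAK-COUPLING scheme
(`sch.HasWeakCouplingLimit`: β_k → ∞ — free on this line, β_j := b_{k_j} is a subsequence of the
given couplings; the IR-first assembly lives at weak coupling by construction) and OS data T with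
`IsYangMillsFor r sch T`, non-trivial and non-Gaussian curvature, and a mass gap Δ > 0 of the full
Hamiltonian with `HasLatticeMassGap r sch Δ`. Intended scheme: β_j := b_{k_j}, a_j := m*_{k_j}/Δ
with m* the sharp strong rate (mass renormalisation: the spacing IS the strong mixing length, so a_j
→ 0 ⟸ softening and the lattice-gap clause is the hypothesis), subsequential limits by compactness;
what is genuinely open is E1 (rotations), the non-trivial/non-Gaussian renormalisation of tr F²,
strong ⇒ volume-uniform torus clustering of all cylinder observables, and ξ_strong ≍ ξ_bulk (a
boundary-layer gap between the two lengths would make the a_j-limit ultralocal). The restated item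
is implied by rev 4's form (planner Sketch2.lean `sharp_of_old`), hence weaker, and
ThermalRulerBound / RulerSoftens / SofteningCentreBlind are load-bearing again. [difficulty:
open-problem] (why it might fail: this is the existence half of the Clay problem conditioned on
plausible IR inputs: rotation invariance (E1) and a non-Gaussian tr F² at the strong-mixing scale
are not implied by any mixing hypothesis; a Gaussian or ultralocal scaling limit at scale ξ_strong
would refute it.) [JaffeWitten2000, OsterwalderSeiler1978, OsterwalderSchrader1975,
ChatterjeeYMProb2019, arXiv:1912.07973, Literature.Barriers.QuantumFields.ScalarPhi4Triviality,
Literature.Barriers.QuantumFields.FixedCouplingUltralocality]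
#6 StrongGapSeqAllG (crux) — STRONG LATTICE GAP ALONG A SEQUENCE, EVERY G (IR input L1 in
strong-mixing form): every compact simple Lie group G has a faithful unitary lattice representation
r and couplings b_k → ∞ such that at each b_k Wilson's theory in r satisfies StrongExpDecay(r.ρ,
b_k, 4, m_k) for some m_k ∈ (0,1] (cubes of ℤ⁴, arbitrary boundary conditions, edge-local
observables). A sequence, not all couplings: bulk first-order points (SU(N ≥ 5) Wilson action) are
allowed to be skipped. [difficulty: open-problem] (why it might fail: Chatterjee2021 §2.4 warns the
mass-gap conjecture may not include the boundary-uniform version; adversarial boundary holonomies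
could keep a boundary layer ordered at every large β (then the ruler's dichotomy always takes its
first branch and the line is idle).) [Chatterjee2021, ChatterjeeYMProb2019, Borgs1988]
#7 SofteningCentreBlind (crux) — SOFTENING WHERE THE RULER IS SILENT: for every compact simple Lie
group G and faithful unitary lattice representation r such that NO central element acts in r by a
scalar ≠ 1 (centreless G: G₂, F₄, E₈, all adjoint forms; Spin(4k), which has no faithful irreducible
representation; reducible centre-mixing r), every sequence of strong-decay rates m_k ∈ (0,1] (K₁ =
4) along couplings b_k → ∞ tends to 0 (the lattice strong mixing length diverges). For
representations that do see the centre this is the support item RulerSoftens (from the target); here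
no thermal order parameter exists. [difficulty: open-problem] (why it might fail: no order
parameter: for centre-blind representations Wilson/Polyakov criteria fail already at strong coupling
(arXiv:2605.16162, SO(3)), so softening must come from asymptotic freedom itself —
ChatterjeeYMProb2019 Problem 5.1, open, no mechanism offered here.) [arXiv:2605.16162,
ChatterjeeYMProb2019, BorgsSeiler1983]
#9 RulerFromCruxes (support) — GLUE (card P1's arithmetic half, provable now; rev 3: pure
arithmetic): LinearDeconfinementWindow → QuantCentreRestoration → ThermalRulerBound. Item 2 at d = 3
gives C₀ = C₀(G, ρ) with Polyakov LRO at (3, L₀, ρ, β, β) whenever β ≥ C₀·L₀; given β ≥ max(2, 2C₀)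
put L₀ := ⌊β/C₀⌋ ≥ 1 (so C₀L₀ ≤ β): crux 3 then forbids A·log(βK₁/K₂)^a ≤ K₂⁴L₀, so K₂⁴β < K₂⁴·2C₀L₀
< 2C₀·A·log(βK₁/K₂)^a; for 2 ≤ β < 2C₀ use K₂ ≤ 1 and log(βK₁/K₂) ≥ log 4 > 1. [difficulty:
provable-now] [BorgsSeiler1983, Chatterjee2021]
#9 RulerSoftens (support) — GLUE (real analysis, provable now): ThermalRulerBound → for every
compact simple Lie G (borel σ-algebra), every faithful r : LatticeRep G and central z with r.ρ z =
ω•1, ω ≠ 1, every sequence b_k → ∞ with strong-decay rates m_k ∈ (0,1] (K₁ = 4) has m_k → 0. Proof: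
`ConnectedSpace G` from `IsSimpleCompactGroup`, second countability from the closed embedding r.ρ, 0
< r.N since G is non-abelian; then m_k⁴ b_k ≤ C log(4b_k/m_k)^a eventually, and m_k ≥ ε frequently
would give ε⁴b_k ≤ C log(4b_k/ε)^a along b_k → ∞, absurd. [difficulty: provable-now]
[Chatterjee2021, BorgsSeiler1983]

TWO-LAYER PLAN. Foreseen glued splits (k ≤ 3, depth 1), filed only after a crux closes or stalls
with a census:
QuantCentreRestoration ⇐ QuantSlabCoupling (Chatterjee Lemmas 7.1–11.1 with explicit
(K₁,K₂,β,n)-constants for the slab with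
fixed temporal faces and periodic space: boundary-influence / disagreement bound exp(−c·dist/N) for
N ≥ A K₂⁻⁴ polylog) →
SliceBridge (finite-volume conditioning of `FiniteTemperature.expectation` on the time-zero slice +
exact centre symmetry of the
slab measure ⇒ sup_η |E_η[Re χ(P_0)χ̄(P_x)]| small ⇒ uniform decay of `polyakovCorrelation` ⇒ ¬LRO)
→ QuantCentreRestoration.
LinearDeconfinementWindow ⇐ FILSInequality ((III.32): non-negative spatial transfer matrix ⇒ (1 −
cos p₁)Ĝ_h ≤ ½⟨double commutator⟩,
via the tree's lattice RP mechanism) → DoubleCommutatorExpansion ((III.43)–(III.58): Gaussian kernel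
on ℂ^(n²), terminating
expansion in J_E⁻¹, |W(C)| ≤ χ(1); together = the rev-2 Fourier-side ExplicitInfraredBound, whose
module the children's Theorems files
import, not the route file) → LinearDeconfinementWindow (glue proved: planner folder Equiv.lean).
ContinuumFromMixing ⇐ TightnessAndGapTransfer (mass-renormalised scheme, E0/E0'/E2/E3/E4, clustering
passes to the limit) →
RotationInvarianceE1 → NontrivialNonGaussianCurvature → ContinuumFromMixing.

KILL CRITERIA. Close `refuted:StrongGapSeqAllG` if strong (boundary-uniform) decay is shown to fail
at all large β for some compact simple G in
every faithful representation (the dichotomy then always takes its first branch and the ruler is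
idle) — the witness goes to the
negatives index as "no boundary-uniform gap in 4D YM". A refutation of LinearDeconfinementWindow
that only exhibits a different
L₀-dependence of the threshold forces a PIVOT (restate with the true J₀(L₀); a super-linear window
gives ξ_s ≥ c·log β — keep the route only if the
rate stays at least polynomial); a refutation of QuantCentreRestoration's exponent 4 likewise
restates with K₂^p. TorusToStrong
refuted by a boundary-ordering example ⇒ drop it (not load-bearing) and record that the ruler never
speaks about the torus rate.
ContinuumFromMixing / SofteningCentreBlind refuted ⇒ the summit clause fails for that G: escalate
(statement-level finding), close.
Mooted if another route proves softening with an exponential rate (ξ ≥ e^(cβ)) for all G, or proves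
`YangMills` outright; if
EquipartitionCriticality's RPProbeCriticality lands (rate-free softening in torus form) the
strong-form SofteningCentreBlind is NOT
settled by it (torus ⇒ strong is crux 4), but the two routes' UV legs should then be merged by a
tenure pass.

NOT DECOMPOSED YET. The constants (A, a) and the block-radius optimisation inside
QuantCentreRestoration; the periodic-versus-free spatial boundary
bookkeeping; the Fourier-side infrared bound with its printed rate (rev-2 ExplicitInfraredBound) and
the inversion arithmetic, which now ride
inside the proof of LinearDeconfinementWindow as `--supports` lemmas; the easy direction strong ⇒
torus clustering of general cylinder observables (inside ContinuumFromMixing); the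
U(N) clause and sharper N-dependence (β ≥ 4N·L₀) of the window, irrelevant to the summit; any
general-d version (d = 3+1 only).

CHEAPEST FALSIFIER. (i) Re-derive BorgsSeiler1983 (III.57)–(III.59) from the materialised pp.
351–353: is f really Σ_k C(L₀,k)(2χ(1)/J_E)^k =
(1 + 2χ(1)/J_E)^L₀ − 1 with NO further L₀-dependence? (read: yes — the expansion terminates at k =
L₀ and each broken loop costs
χ(1)/J_E; a refuter should redo the count of broken-loop sets). (ii) Chatterjee2021 Lemma 7.1 (read,
p. 14): C₂ = K₂ exactly and
C₁ ∝ |β|K₁ — done, consistent; Lemma 11.1 with r = (N/4C₃)^(1/4): the two coefficients are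
C₁N⁶r³e^(−K₂r) and C₃r⁴/N, so
N₀ ≍ K₂⁻⁴(log(βK₁N₀))⁴ — one afternoon of bookkeeping kills or confirms the exponent. (iii) Sanity
already checked in Lean: the
target is silent for centre-blind ρ (hypothesis ρ z = ω•1, ω ≠ 1, 0 < n) and for
non-second-countable junk groups (binder added);
K₁ ≥ 2 keeps the distance-0 covariance (≤ 2) admissible, K₂ ≤ 1 keeps small β trivial.

NUMBERS. BorgsSeiler1983: I(3) = 0.5054620197 (p. 347); one layer: quarks liberated for J_E ≥ N·I(d)
(Cor. III.5, (III.19)); L₀ layers: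
f(J_E) = (1 + 2χ(1)/J_E)^L₀ − 1 (Lemma III.6, p. 348), LRO once 3·f(β)·I(3) < 1, i.e. β ≥
2N·L₀/log(1 + 1/(3I(3))) ≈ 3.95·N·L₀
(SU(3): β ≳ 12·L₀; physical deconfinement L₀,c(β) ~ e^(cβ), so the window is far from sharp but
linear). Chatterjee2021 Lemma 11.1:
coefficients C₁N^(2d−2)e^(−C₂r) and C₃r^d/N must be < 1/4 with r ≤ N/4; with C₂ = K₂, d = 4, r =
(N/4C₃)^(1/4):
N₀ ≲ C·K₂⁻⁴·(log(βK₁/K₂))⁴, so ξ_s := 1/K₂ ≥ c(β/log⁴)^(1/4). Expected truth: ξ ~ e^(cβ) (asymptotic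
freedom); T_c ≈ 0.63√σ (SU(3)).
Items at open: 10 (1 target, 6 cruxes, 2 supports, 1 assembly).

DEFINITION REQUESTS. `StrongExpDecay ρ β K₁ K₂` (Chatterjee2021 Def. 2.3 over
`QuantumLattice.ymSpecification`; topic Literature/MathematicalPhysics/QuantumLattice)
and `EdgeLocalTorusDecay ρ β K m` are INLINED verbatim in the items (text in the planner folder,
items.json) so that everything
elaborates today; a definition item for `StrongExpDecay` is filed after open for reuse by other
IR-first routes (restating the
items over it would be cosmetic and is not planned). No cite facts requested: the Borgs–Seiler
inputs are the tree's
`FiniteTemperature.*` predicates, and the quantitative Chatterjee theorem is new bookkeeping, filed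
as crux 3 rather than as a fact. CONE REPAIR (route-repair g2, 2026-08-15): the seven decay-inlining
items write the sup-distance of base points `‖e₁.1 - e₂.1‖` where rev 1 wrote
`QuantumFieldTheory.setDistEdges {e₁} {e₂}` (equal for singletons), so the route file no longer
imports `…QuantumFieldTheory.LatticeGauge`/`Sweep1` and their unproved facts
(LatticeMassGapAllCouplings, shenZhuZhu_strongCoupling, chatterjee_isingGauge_wilsonLoop,
ChatterjeeMassGapProblem, aizenmanDuminilCopin_…); the landed `QuantumLattice.StrongExpDecay`
(StrongExpDecayLGT.lean) matches the inlined hypothesis up to that rewrite (`strongExpDecay_iff`).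
Library request (no item): relocate `setDistEdges` into an import-light module so IR-first routes
can state things over `StrongExpDecay` without pulling `Sweep1` into their cones. The BS83 §III.2
formalisation in its explicit printed form
`Literature.Barriers.QuantumFields.BorgsSeilerInfraredBoundExplicit`
(FiniteTemperatureInfraredExplicit.lean) discharges `BorgsSeilerInfraredBound` (`.of_explicit`,
proved) and `FiniteTemperatureDeconfinement` (`.of_infraredBound` with
`BorgsSeilerPolyakovDiagonal_holds`, proved), and — pushed forward along ρ — item 2. CONE REPAIR
(route-repair g3, 2026-08-15): the route file now imports the BASE barrier module
`Literature.Barriers.QuantumFields.FiniteTemperatureDeconfinement` instead of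
`…FiniteTemperatureDeconfinementInfrared`, whose closure alone added 16 modules
(InfraredLongRangeOrder → LatticeGreenRiemannSum → SharpnessProofs → the Ising/percolation stack)
and the unproved facts `BorgsSeilerInfraredBound`, `aizenman_higuchi`,
`bodineau_translationInvariant` as passengers; only item 2 and RulerFromCruxes used that module and
are restated on the position side (above). What remains route-attributable in the module cone is
exactly ONE unproved fact, unavoidable because its file hosts the `FiniteTemperature.*` vocabulary
(Config/expectation/polyakovCorrelation/IsThermodynamicLimit/HasPolyakovLongRangeOrder) in which
items 2–3 are stated, and GENUINELY NEEDED — needs-fact: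
Literature.Barriers.QuantumFields.FiniteTemperatureDeconfinement (item 2 implies it; its tier-0
proof is the BS83 §III.2 formalisation just named, after which item 2 is ~40 lines). Everything else
unproved in the cone (isSpecification_ymSpecification, not_isSimpleCompactGroup_unitaryGroup, the
`[status: open]` Clay/Cao–Park–Sheffield problems) rides in on the mandatory
`Summits.QuantumFields.Statement` and is common to every YangMills route. Library request (no item):
move the `FiniteTemperature.*` vocabulary into an import-light definitions module and cut the edge
InfraredLongRangeOrder → SharpnessProofs (it needs latticeGreen/Riemann sums, not Ising sharpness),
so finite-temperature items get a fact-free cone.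

Novelty: Searches (2026-08-15): `lit frontier QuantumFields --since 2021` (30 rows; 2026 descendants incl.
arXiv:2605.16162 SO(3) deconfinement at
strong coupling, arXiv:2605.02156 survey, arXiv:2606.19362 claimed RP construction — none combines
BS83 with Chatterjee 2021);
`lit bridges QuantumFields --cross any` (30 rows, percolation/Ising bridges only); `lit citing
doi:10.1007/s00220-021-04086-y` (22 citing
works: arXiv:2505.16585 uses Thm 2.4 forward as "a sufficient condition for area law",
arXiv:2202.10375 finite groups, none contrapositive
or quantitative); `lit galaxy search "unbroken center symmetry" --star all` (7 rows: Greensite LNP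
972, Shuryak LNP 977 — physics
heuristics T_c vs string tension, no theorem), `lit galaxy search "Borgs-Seiler" / "deconfinement at
nonzero temperature lattice" /
"strong mixing implies uniqueness slab" --star all` (0 rows each); `lit search` (searchd unavailable
today, rc 75 — the card's own
searches of 2026-08-15 stand: crossref/zbmath rows BS83, Borgs88, SO(3) numerics only); read
BorgsSeiler1983 pp. 344–354 and
Chatterjee2021 pp. 5–7, 14–22 in full.
Nearest prior art found: BorgsSeiler1983 (doi:10.1007/bf01208780, Thm III.7: deconfinement for J_E ≳
χ(1)L₀ — a barrier, used here as
input); Chatterjee2021 (doi:10.1007/s00220-021-04086-y = arXiv:2006.16229, Thm 2.4: strong decay ⇒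
centre symmetry ⇒ area law,
forward and qualitative, cites BS83 only as an analogy); Borgs1988 (doi:10.1007/bf01225259,
freezing/deconfinement with continuous
time); ca  [refs: 10.1007/s00220-021-04086-y`, 10.1007/bf01208780, 10.1007/s00220-021-04086-y, 10.1007/bf01225259, 2605.16162, 2605.02156, 2606.19362, 2505.16585, 2202.10375, 2006.16229, doi:10.1007/s00220-021-04086-y, doi:10.1007/bf01208780, doi:10.1007/bf01225259, BorgsSeiler1983, Chatterjee2021, Borgs1988]

Barriers (technique_class: finite-temperature-ruler, infrared-bound, centre-symmetry): - technique_class: finite-temperature-ruler, infrared-bound, centre-symmetry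
- Literature.Barriers.QuantumFields.FiniteTemperatureDeconfinement: not evaded but USED — the
barrier theorem (in its quantitative form, crux 2) is the ruler; nothing temperature-blind is
claimed: the hypothesis lives at L₀ ≤ β/C where the barrier says deconfinement holds, the conclusion
is about T = 0 mixing lengths.
- Literature.Barriers.QuantumFields.CenterSymmetryBreakingByQuarks: respected — pure gauge only;
with dynamical matter the Polyakov loop is no order parameter and the ruler correctly breaks (QCD
conjunct out of scope).
- Literature.Barriers.QuantumFields.AbelianDeconfinementD4: no conflict — for U(1)/U(N) (central
scalar present) the target is vacuously true at large β because strong decay fails in the Coulomb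
phase; the legs quantify over compact SIMPLE G only, and nothing group-blind asserts clustering.
- Literature.Barriers.QuantumFields.ZnHiggsPhaseD4: consistent — discrete (disconnected) gauge
groups are massive yet have several Gibbs states at large β, so boundary-uniform decay fails there
and the ruler would be idle; the target carries `ConnectedSpace G` (Chatterjee's boundary-influence
lemma needs paths in G), the legs quantify over compact simple (connected) G, and no finite-subgroup
approximation is used anywhere.
- Literature.Barriers.QuantumFields.FixedCouplingUltralocality: aligned — softening (mixing length →
∞ along the scheme, a_k → 0) is exactly what this barrier demand

Novelty grade: new-combination — ROUTE REVIEW refuter rreview-0815T13-8 (2026-08-15). NOVELTY new-combination confirmed per card audit u5 (BS83 run contrapositively + quantitatively against Chatterjee 2021; no rigorous T_c-vs-mixing-length inequality for 4D SU(N) in print); I re-read BS pp.348-353 on the held scan confirming the LI (refuter refuter-rreview-0815T13-8-0, 2026-08-15T14:25:34Z; prior: doi:10.1007/bf01208780 BorgsSeiler1983 Lemma III.6 / Thm III.7 (p.348: f(J_E)=(1+2chi(1)/J_E)^L0 - 1, verified on held scan), doi:10.1007/s00220-021-04086-y = arXiv:2006.16229 Chatterjee2021 Thm 2.4, doi:10.1007/bf01225259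 Borgs1988, doi:10.1007/bf02101929 MartinelliOlivieri1994 (weak vs strong mixing))

History (route lifecycle, newest last):
- 2026-08-15T16:14:58Z · rev 2: restated ThermalRulerBound (stmt-QuantumFields-9016), QuantCentreRestoration (stmt-QuantumFields-9018), TorusToStrong (stmt-QuantumFields-9019), ContinuumFromMixing (stmt-QuantumFields-9020), StrongGapSeqAllG (stmt-QuantumFields-9021), SofteningCentreBlind (stmt-QuantumFields-9022), RulerSoftens (stmt-QuantumFie (planner-rrepair-QuantumFields-ThermalRuler-a42fadc6-g2-0)
- 2026-08-15T16:48:42Z · rev 3: restated ExplicitInfraredBound (stmt-QuantumFields-9017), RulerFromCruxes (stmt-QuantumFields-9023) — cone repair (rrepair g3): import Literature.Barriers.QuantumFields.FiniteTemperatureDeconfinementInfrared → base module Literature.Barriers.QuantumFields.Finite (planner-rrepair-QuantumFields-ThermalRuler-a42fadc6-g3-0)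
- 2026-08-16T04:16:05Z · AUTO-CRUX (backfill): ThermalRulerBound — hypotheses of the deciding theorem that nothing in the route derives are cruxes (operator:999:1085951)
- 2026-08-16T17:42:00Z · rev 5: restated ContinuumFromMixing (stmt-QuantumFields-10416) (planner-rrepair-QuantumFields-ThermalRuler-stm-9e1d6168-0)
- 2026-08-23T07:19:09Z · DORMANT — reconciler: no traction for 6 d (last activity item-evidence-added at 2026-08-17T07:23:30Z); parked, not closed — `ledger route dormant route-QuantumFields-Ther (operator:999:2529465)

sub-problem: YangMills · status: dormant · opened planner-plancard-QuantumFields-YangMills-ther-18a9aa36-0 2026-08-15T13:47:25Z · rev 6 · ledger route-QuantumFields-ThermalRuler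
GENERATED by the gate from the ledger (D-0016/17). Provers cite these decls: `theorem foo : Summit.QuantumFields.YangMills.Theses.ThermalRuler.<Decl> := …` in Summits/QuantumFields/YangMills/Theorems/<Name>.lean.
-/

namespace Summit.QuantumFields.YangMills.Theses.ThermalRuler

open scoped BigOperators Topology Manifold Classical MeasureTheory ProbabilityTheory Matrix InnerProductSpace ComplexConjugate ContinuousMap
open Filter Set Function TopologicalSpace MeasureTheory

attribute [summit_statement] _root_.YangMills

-- earlier ThermalRulerBound (stmt-QuantumFields-9016, replaced 2026-08-15T16:14:58Z -> stmt-QuantumFields-10413): retired by None — ∀ (G : Type) [Group G] [TopologicalSpace G] [IsTopologicalGroup G] [CompactSpace G] [SecondCountableTopology G] [MeasurableSpace G] [BorelSpace G] [ConnectedSpace G] (n : ℕ) (ρ : G →* Matrix (Fin n) (Fin n) ℂ) (z : G) (ω : ℂ), 0 < n → Continuous ρ → (∀ g, ρ g ∈ Matrix.u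
/-- item stmt-QuantumFields-10413 · crux (kind.auto-crux: conjecture-grade) · rank 0 · open · by planner
why it might fail: An implication: false only if a centre-charged (G,rho) keeps boundary-uniform decay with K2 >> (polylog/beta)^(1/4) at arbitrarily large beta (physics: xi ~ e^{c beta}; torus factors are Coulomb, hypothesis void). Real risks: rate rests on 9018's K2^-4 polylog + BS83's linear window; true but idle.
sources: BorgsSeiler1983, Chatterjee2021, arXiv:2006.16229, ChatterjeeYMProb2019
[target] the thermal ruler bound X above: for (G, ρ, z, ω) with ρ continuous unitary, z central, ρ z
= ω•1, ω ≠ 1, 0 < n: ∃ C a, ∀ β ≥ 2, ∀ K₁ ≥ 2, ∀ K₂ ∈ (0,1], StrongExpDecay(ρ, β, K₁, K₂) [inlined: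
all cubes v+[0,M]⁴ of ℤ⁴, all boundary conditions η via `QuantumLattice.ymSpecification ρ β
(interior edges) η`, all measurable edge-local f, g (supports = plaquette-neighbourhoods of edges of
the cube) with |f|,|g| ≤ 1: |E fg − Ef·Eg| ≤ K₁ exp(−K₂·setDistEdges)] → K₂⁴·β ≤ C·(log(βK₁/K₂))^a. -/
@[route_item "route-QuantumFields-ThermalRuler", crux]
def ThermalRulerBound : Prop :=
  ∀ (G : Type) [Group G] [TopologicalSpace G] [IsTopologicalGroup G] [CompactSpace G] [SecondCountableTopology G] [MeasurableSpace G] [BorelSpace G] [ConnectedSpace G] (n : ℕ) (ρ : G →* Matrix (Fin n) (Fin n) ℂ) (z : G) (ω : ℂ), 0 < n → Continuous ρ → (∀ g, ρ g ∈ Matrix.unitaryGroup (Fin n) ℂ) → (∀ g : G, z * g = g * z) → ω ≠ 1 → ρ z = ω • (1 : Matrix (Fin n) (Fin n) ℂ) → ∃ C : ℝ, ∃ a : ℕ, 0 < C ∧ ∀ (β K₁ K₂ : ℝ), 2 ≤ β → 2 ≤ K₁ → 0 < K₂ → K₂ ≤ 1 → (∀ (M : ℕ) (v : Fin 4 → ℤ)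 (Λ : Finset (Literature.MathematicalPhysics.QuantumLattice.ZdEdge 4)) (η : Literature.MathematicalPhysics.QuantumLattice.LGConfig 4 G) (e₁ e₂ : Literature.MathematicalPhysics.QuantumLattice.ZdEdge 4) (f g : Literature.MathematicalPhysics.QuantumLattice.LGConfig 4 G → ℝ), Λ = (((Fintype.piFinset fun j : Fin 4 => Finset.Icc (v j) (v j + M)) ×ˢ (Finset.univ : Finset (Fin 4))).filter fun e => e.1 e.2 + 1 ≤ v e.2 + M ∧ ∀ j, j ≠ e.2 → v j < e.1 j ∧ e.1 j < v j + M) → (∀ j, v j ≤ e₁.1 j ∧ e₁.1 j ≤ v j + M) → e₁.1 e₁.2 + 1 ≤ v e₁.2 + M → (∀ j, v j ≤ e₂.1 j ∧ e₂.1 j ≤ v j + M) → e₂.1 e₂.2 + 1 ≤ v e₂.2 + M → Measurable f → Measurable g → Literature.MathematicalPhysics.QuantumLattice.IsCylinder f ((Literature.MathematicalPhysics.QuantumLattice.plaquettesTouching {e₁}).biUnion Literature.MathematicalPhysics.QuantumLattice.plaquetteEdges) → Literature.MathematicalPhysics.QuantumLattice.IsCylinder g ((Literature.MathematicalPhysics.QuantumLattice.plaquettesTouching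 {e₂}).biUnion Literature.MathematicalPhysics.QuantumLattice.plaquetteEdges) → (∀ U, |f U| ≤ 1) → (∀ U, |g U| ≤ 1) → |(∫ U, f U * g U ∂(Literature.MathematicalPhysics.QuantumLattice.ymSpecification (d := 4) ρ β Λ η)) - (∫ U, f U ∂(Literature.MathematicalPhysics.QuantumLattice.ymSpecification (d := 4) ρ β Λ η)) * (∫ U, g U ∂(Literature.MathematicalPhysics.QuantumLattice.ymSpecification (d := 4) ρ β Λ η))| ≤ K₁ * Real.exp (-(K₂ * ‖e₁.1 - e₂.1‖))) → K₂ ^ 4 * β ≤ C * Real.log (β * K₁ / K₂) ^ a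

-- earlier QuantCentreRestoration (stmt-QuantumFields-9018, replaced 2026-08-15T16:14:58Z -> stmt-QuantumFields-10414): retired by None — ∀ (G : Type) [Group G] [TopologicalSpace G] [IsTopologicalGroup G] [CompactSpace G] [SecondCountableTopology G] [MeasurableSpace G] [BorelSpace G] [ConnectedSpace G] (n : ℕ) (ρ : G →* Matrix (Fin n) (Fin n) ℂ) (z : G) (ω : ℂ), 0 < n → Continuous ρ → (∀ g, ρ g ∈ Mat
/-- item stmt-QuantumFields-10414 · crux · rank 3 · open · by planner
why it might fail: Rate can be lost: Lemma 11.1's recursion has coefficients C1 N^{2d-2} e^{-C2 r}, C3 r^d/N, r=(log N)^2, N0(G,beta,d) unquantified; if the Lemma 9-10 constants degrade with (beta,K1), r ~ N^{1/4} gives only N0 ~ exp(c/K2) (xi_s >~ log beta, exponent 4 dead); periodic 3+1 slabs, L->oo swap unprinted.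
sources: Chatterjee2021, arXiv:2006.16229, BorgsSeiler1983
[crux] QUANTITATIVE CHATTERJEE IN THE PERIODIC BOX (card K1 + P1, finite volume): for (G, ρ, z, ω)
as in the target (G connected) there are A, a such that for β ≥ 2, K₁ ≥ 2, K₂ ∈ (0,1]:
StrongExpDecay(ρ, β, K₁, K₂) ⇒ for every temporal extent L₀ with A·(log(βK₁/K₂))^a ≤ K₂⁴·L₀ the
isotropic finite-temperature theory (J_E = J_M = β, d = 3 space dimensions) has NO Polyakov
long-range order, `¬ FiniteTemperature.HasPolyakovLongRangeOrder 3 L₀ ρ β β`. Intended proof: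
Chatterjee2021 Lemmas 7.1–11.1 with explicit constants (C₂ = K₂, C₁ ∝ βK₁·n, block radius r ≍
(N/4C₃)^(1/4) instead of (log N)²) give a coupling of the slab of thickness N = L₀ with two boundary
conditions agreeing on the temporal faces whose disagreement probability decays like exp(−c·dist/N);
condition the periodic box ℤ_L₀×(ℤ/L)³ on its time-zero spatial links (Fubini on the finite product
Haar space): the slab measure with top = bottom = η is EXACTLY invariant under the centre transform,
so E_η[χ(P_x)] = ω·E_η[χ(P_x)] = 0, and the coupling gives |E_η[χ(P_0)χ̄(P_x)]| ≤ 2n²e^(−c‖x‖/L₀)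
uniformly in η and L; hence every thermodynamic limit of G_L tends to 0 (limits exist:
`exists_isThermodynamicLimit`). [difficulty: XL] -/
@[route_item "route-QuantumFields-ThermalRuler"]
def QuantCentreRestoration : Prop :=
  ∀ (G : Type) [Group G] [TopologicalSpace G] [IsTopologicalGroup G] [CompactSpace G] [SecondCountableTopology G] [MeasurableSpace G] [BorelSpace G] [ConnectedSpace G] (n : ℕ) (ρ : G →* Matrix (Fin n) (Fin n) ℂ) (z : G) (ω : ℂ), 0 < n → Continuous ρ → (∀ g, ρ g ∈ Matrix.unitaryGroup (Fin n) ℂ) → (∀ g : G, z * g = g * z) → ω ≠ 1 → ρ z = ω • (1 : Matrix (Fin n) (Fin n) ℂ) → ∃ A : ℝ, ∃ a : ℕ, 0 < A ∧ ∀ (β K₁ K₂ : ℝ), 2 ≤ β → 2 ≤ K₁ → 0 < K₂ → K₂ ≤ 1 → (∀ (M : ℕ) (v : Fin 4 → ℤ) (Λ : Finset (Literature.MathematicalPhysics.QuantumLattice.ZdEdge 4)) (η : Literature.MathematicalPhysics.QuantumLattice.LGConfig 4 G) (e₁ e₂ : Literature.MathematicalPhysics.QuantumLattice.ZdEdge 4)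 (f g : Literature.MathematicalPhysics.QuantumLattice.LGConfig 4 G → ℝ), Λ = (((Fintype.piFinset fun j : Fin 4 => Finset.Icc (v j) (v j + M)) ×ˢ (Finset.univ : Finset (Fin 4))).filter fun e => e.1 e.2 + 1 ≤ v e.2 + M ∧ ∀ j, j ≠ e.2 → v j < e.1 j ∧ e.1 j < v j + M) → (∀ j, v j ≤ e₁.1 j ∧ e₁.1 j ≤ v j + M) → e₁.1 e₁.2 + 1 ≤ v e₁.2 + M → (∀ j, v j ≤ e₂.1 j ∧ e₂.1 j ≤ v j + M) → e₂.1 e₂.2 + 1 ≤ v e₂.2 + M → Measurable f → Measurable g → Literature.MathematicalPhysics.QuantumLattice.IsCylinder f ((Literature.MathematicalPhysics.QuantumLattice.plaquettesTouching {e₁}).biUnion Literature.MathematicalPhysics.QuantumLattice.plaquetteEdges) → Literature.MathematicalPhysics.QuantumLattice.IsCylinder g ((Literature.MathematicalPhysics.QuantumLattice.plaquettesTouching {e₂}).biUnion Literature.MathematicalPhysics.QuantumLattice.plaquetteEdges) → (∀ U, |f U| ≤ 1) → (∀ U, |g U| ≤ 1) → |(∫ U, f U * g U ∂(Literature.MathematicalPhysics.QuantumLattice.ymSpecification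 (d := 4) ρ β Λ η)) - (∫ U, f U ∂(Literature.MathematicalPhysics.QuantumLattice.ymSpecification (d := 4) ρ β Λ η)) * (∫ U, g U ∂(Literature.MathematicalPhysics.QuantumLattice.ymSpecification (d := 4) ρ β Λ η))| ≤ K₁ * Real.exp (-(K₂ * ‖e₁.1 - e₂.1‖))) → ∀ (L₀ : ℕ) [NeZero L₀], A * Real.log (β * K₁ / K₂) ^ a ≤ K₂ ^ 4 * L₀ → ¬ Literature.Barriers.QuantumFields.FiniteTemperature.HasPolyakovLongRangeOrder 3 L₀ ρ β β

-- earlier TorusToStrong (stmt-QuantumFields-9019, replaced 2026-08-15T16:14:58Z -> stmt-QuantumFields-10415): retired by None — ∀ (G : Type) [Group G] [TopologicalSpace G] [IsTopologicalGroup G] [CompactSpace G] [SecondCountableTopology G] [MeasurableSpace G] [BorelSpace G] (n : ℕ) (ρ : G →* Matrix (Fin n) (Fin n) ℂ), Continuous ρ → (∀ g, ρ g ∈ Matrix.unitaryGroup (Fin n) ℂ) → ∃ C : ℝ, 0 < C ∧ ∀ (β 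
/-- item stmt-QuantumFields-10415 · crux · rank 4 · open · by planner
why it might fail: May be false as typed: in d >= 3 torus/bulk (weak) mixing does not imply strong mixing - Czech models: unique bulk state, half-space non-uniqueness (Shlosman 1986); weak => strong is a 2-D theorem (Martinelli-Olivieri-Schonmann 94); gauge boundary holonomies can pin ordered layers; uniform C: guess.
sources: MartinelliOlivieri1994, doi:10.1007/bf02099735, doi:10.1007/bf01018227, doi:10.1007/bf02101930, Chatterjee2021
[crux] FROM TORUS TO STRONG MIXING (card K2 — the bridge from the ruler's quantity to the
Statement's `HasLatticeMassGap` torus quantity): for every compact second-countable G and continuous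
unitary ρ there is C > 0 such that for β ≥ 1, K ≥ 2, m > 0: if on EVERY symmetric torus of side 2S+1
(tree `wilsonMeasure (d := 4) (L := 2S+1) ρ β`, observables pulled back by `torusLift`) edge-local
f, g bounded by 1 at torus distance ≤ S satisfy |E fg − Ef·Eg| ≤ K·exp(−m·dist), then
StrongExpDecay(ρ, β, C·K·β, m/C) holds (cubes with arbitrary boundary conditions). With the target:
volume-uniform torus clustering at rate m at coupling β forces m⁴β ≤ C'·polylog, i.e. the torus rate
of any `HasLatticeMassGap` witness closes at least like β_k^(−1/4+o(1)). [difficulty: XL] -/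
@[route_item "route-QuantumFields-ThermalRuler"]
def TorusToStrong : Prop :=
  ∀ (G : Type) [Group G] [TopologicalSpace G] [IsTopologicalGroup G] [CompactSpace G] [SecondCountableTopology G] [MeasurableSpace G] [BorelSpace G] (n : ℕ) (ρ : G →* Matrix (Fin n) (Fin n) ℂ), Continuous ρ → (∀ g, ρ g ∈ Matrix.unitaryGroup (Fin n) ℂ) → ∃ C : ℝ, 0 < C ∧ ∀ (β K m : ℝ), 1 ≤ β → 2 ≤ K → 0 < m → (∀ (S : ℕ) (e₁ e₂ : Literature.MathematicalPhysics.QuantumLattice.ZdEdge 4) (f g : Literature.MathematicalPhysics.QuantumLattice.LGConfig 4 G → ℝ), (∀ j, |e₁.1 j| ≤ S ∧ |e₂.1 j| ≤ S ∧ |e₁.1 j - e₂.1 j| ≤ S) → Measurable f → Measurable g → Literature.MathematicalPhysics.QuantumLattice.IsCylinder f ((Literature.MathematicalPhysics.QuantumLattice.plaquettesTouching {e₁}).biUnion Literature.MathematicalPhysics.QuantumLattice.plaquetteEdges) → Literature.MathematicalPhysics.QuantumLattice.IsCylinder g ((Literature.MathematicalPhysics.QuantumLattice.plaquettesTouching {e₂}).biUnion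 Literature.MathematicalPhysics.QuantumLattice.plaquetteEdges) → (∀ U, |f U| ≤ 1) → (∀ U, |g U| ≤ 1) → |(∫ U, f (Literature.MathematicalPhysics.QuantumLattice.torusLift (2 * S + 1) U) * g (Literature.MathematicalPhysics.QuantumLattice.torusLift (2 * S + 1) U) ∂(Literature.MathematicalPhysics.QuantumFieldTheory.wilsonMeasure (d := 4) (L := 2 * S + 1) ρ β)) - (∫ U, f (Literature.MathematicalPhysics.QuantumLattice.torusLift (2 * S + 1) U) ∂(Literature.MathematicalPhysics.QuantumFieldTheory.wilsonMeasure (d := 4) (L := 2 * S + 1) ρ β)) * (∫ U, g (Literature.MathematicalPhysics.QuantumLattice.torusLift (2 * S + 1) U) ∂(Literature.MathematicalPhysics.QuantumFieldTheory.wilsonMeasure (d := 4) (L := 2 * S + 1) ρ β))| ≤ K * Real.exp (-(m * ‖e₁.1 - e₂.1‖))) → (∀ (M : ℕ) (v : Fin 4 → ℤ) (Λ : Finset (Literature.MathematicalPhysics.QuantumLattice.ZdEdge 4)) (η : Literature.MathematicalPhysics.QuantumLattice.LGConfig 4 G) (e₁ e₂ : Literature.MathematicalPhysics.QuantumLattice.ZdEdge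 4) (f g : Literature.MathematicalPhysics.QuantumLattice.LGConfig 4 G → ℝ), Λ = (((Fintype.piFinset fun j : Fin 4 => Finset.Icc (v j) (v j + M)) ×ˢ (Finset.univ : Finset (Fin 4))).filter fun e => e.1 e.2 + 1 ≤ v e.2 + M ∧ ∀ j, j ≠ e.2 → v j < e.1 j ∧ e.1 j < v j + M) → (∀ j, v j ≤ e₁.1 j ∧ e₁.1 j ≤ v j + M) → e₁.1 e₁.2 + 1 ≤ v e₁.2 + M → (∀ j, v j ≤ e₂.1 j ∧ e₂.1 j ≤ v j + M) → e₂.1 e₂.2 + 1 ≤ v e₂.2 + M → Measurable f → Measurable g → Literature.MathematicalPhysics.QuantumLattice.IsCylinder f ((Literature.MathematicalPhysics.QuantumLattice.plaquettesTouching {e₁}).biUnion Literature.MathematicalPhysics.QuantumLattice.plaquetteEdges) → Literature.MathematicalPhysics.QuantumLattice.IsCylinder g ((Literature.MathematicalPhysics.QuantumLattice.plaquettesTouching {e₂}).biUnion Literature.MathematicalPhysics.QuantumLattice.plaquetteEdges) → (∀ U, |f U| ≤ 1) → (∀ U, |g U| ≤ 1) → |(∫ U, f U * g U ∂(Literature.MathematicalPhysics.QuantumLattice.ymSpecification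 (d := 4) ρ β Λ η)) - (∫ U, f U ∂(Literature.MathematicalPhysics.QuantumLattice.ymSpecification (d := 4) ρ β Λ η)) * (∫ U, g U ∂(Literature.MathematicalPhysics.QuantumLattice.ymSpecification (d := 4) ρ β Λ η))| ≤ (C * K * β) * Real.exp (-((m / C) * ‖e₁.1 - e₂.1‖)))

-- earlier ContinuumFromMixing (stmt-QuantumFields-10416, replaced 2026-08-16T17:42:00Z -> stmt-QuantumFields-16115): retired by None — ∀ (G : Type) [Group G] [TopologicalSpace G] [IsTopologicalGroup G] [CompactSpace G], Literature.MathematicalPhysics.QuantumFieldTheory.IsCompactSimpleLieGroup G → letI : MeasurableSpace G := borel G; haveI : BorelSpace G := ⟨rfl⟩; ∀ (r : Literature.MathematicalPhysic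
-- earlier ContinuumFromMixing (stmt-QuantumFields-9020, replaced 2026-08-15T16:14:58Z -> stmt-QuantumFields-10416): retired by None — ∀ (G : Type) [Group G] [TopologicalSpace G] [IsTopologicalGroup G] [CompactSpace G], Literature.MathematicalPhysics.QuantumFieldTheory.IsCompactSimpleLieGroup G → letI : MeasurableSpace G := borel G; haveI : BorelSpace G := ⟨rfl⟩; ∀ (r : Literature.MathematicalPhysics
/-- item stmt-QuantumFields-16115 · crux · rank 5 · open · by planner
why it might fail: Clay's existence half given IR input: E1 and a non-Gaussian tr F^2 at scale 1/m_k follow from no mixing hypothesis (phi^4_4 archetype, Aizenman-Duminil-Copin 2021); if xi_strong << xi_bulk (boundary layers) the a_k = m_k/Delta limit is ultralocal (FixedCouplingUltralocality). New conjunct: free.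
sources: JaffeWitten2000, arXiv:1912.07973, Literature.Barriers.QuantumFields.ScalarPhi4Triviality, Literature.Barriers.QuantumFields.FixedCouplingUltralocality, OsterwalderSeiler1978, OsterwalderSchrader1975
[crux] THE UV/OS LEG OF THE IR-FIRST ASSEMBLY, SHARP FORM (shared by every lattice-first card; this
route does not attack it; restated 2026-08-16 for the re-typed Statement p116790 — weak-coupling
conjunct — folding in the refuters' sharpness repair of rev 4, rattack-10416 / g43-3
`ContinuumFromMixingSharp`): for every compact simple Lie group G, faithful unitary lattice
representation r and couplings b_k → ∞, IF Wilson's theory in r has strong exponential decay along b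
(K₁ = 4, SOME admissible rates m_k ∈ (0,1]: cubes of ℤ⁴, arbitrary boundary conditions, edge-local
observables) AND EVERY admissible rate sequence along b tends to 0 (the SHARP strong rate softens —
exactly the output shape of RulerSoftens / SofteningCentreBlind; rev 4's "∃ rates with m_k → 0" was
idle because the inlined bound 4·exp(−m_k·dist) is antitone in m_k), THEN the re-typed Clay clause
holds for (G, r): a sequential WEAK-COUPLING scheme sch (`sch.HasWeakCouplingLimit`, β_k → ∞ — free
on this line: β_j := b_{k_j}, a subsequence of the given couplings) and OS data T with
`IsYangMillsFor r sch T`, non-trivial and non-Gaussian curvature, and a mass gap Δ > 0 of the full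
Hamiltonian with `HasLatticeMassGap r sch -/
@[route_item "route-QuantumFields-ThermalRuler", crux]
def ContinuumFromMixing : Prop :=
  ∀ (G : Type) [Group G] [TopologicalSpace G] [IsTopologicalGroup G] [CompactSpace G], Literature.MathematicalPhysics.QuantumFieldTheory.IsCompactSimpleLieGroup G → letI : MeasurableSpace G := borel G; haveI : BorelSpace G := ⟨rfl⟩; ∀ (r : Literature.MathematicalPhysics.QuantumFieldTheory.LatticeRep G) (b : ℕ → ℝ), Filter.Tendsto b Filter.atTop Filter.atTop → (∃ m : ℕ → ℝ, ∀ k, 0 < m k ∧ m k ≤ 1 ∧ (∀ (M : ℕ) (v : Fin 4 → ℤ) (Λ : Finset (Literature.MathematicalPhysics.QuantumLattice.ZdEdge 4)) (η : Literature.MathematicalPhysics.QuantumLattice.LGConfig 4 G) (e₁ e₂ : Literature.MathematicalPhysics.QuantumLattice.ZdEdge 4) (f g : Literature.MathematicalPhysics.QuantumLattice.LGConfig 4 G → ℝ), Λ = (((Fintype.piFinset fun j : Fin 4 => Finset.Icc (v j) (v j + M)) ×ˢ (Finset.univ : Finset (Fin 4))).filter fun e => e.1 e.2 + 1 ≤ v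 e.2 + M ∧ ∀ j, j ≠ e.2 → v j < e.1 j ∧ e.1 j < v j + M) → (∀ j, v j ≤ e₁.1 j ∧ e₁.1 j ≤ v j + M) → e₁.1 e₁.2 + 1 ≤ v e₁.2 + M → (∀ j, v j ≤ e₂.1 j ∧ e₂.1 j ≤ v j + M) → e₂.1 e₂.2 + 1 ≤ v e₂.2 + M → Measurable f → Measurable g → Literature.MathematicalPhysics.QuantumLattice.IsCylinder f ((Literature.MathematicalPhysics.QuantumLattice.plaquettesTouching {e₁}).biUnion Literature.MathematicalPhysics.QuantumLattice.plaquetteEdges) → Literature.MathematicalPhysics.QuantumLattice.IsCylinder g ((Literature.MathematicalPhysics.QuantumLattice.plaquettesTouching {e₂}).biUnion Literature.MathematicalPhysics.QuantumLattice.plaquetteEdges) → (∀ U, |f U| ≤ 1) → (∀ U, |g U| ≤ 1) → |(∫ U, f U * g U ∂(Literature.MathematicalPhysics.QuantumLattice.ymSpecification (d := 4) r.ρ (b k) Λ η)) - (∫ U, f U ∂(Literature.MathematicalPhysics.QuantumLattice.ymSpecification (d := 4) r.ρ (b k) Λ η)) * (∫ U, g U ∂(Literature.MathematicalPhysics.QuantumLattice.ymSpecification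 (d := 4) r.ρ (b k) Λ η))| ≤ 4 * Real.exp (-((m k) * ‖e₁.1 - e₂.1‖)))) → (∀ m : ℕ → ℝ, (∀ k, 0 < m k ∧ m k ≤ 1 ∧ (∀ (M : ℕ) (v : Fin 4 → ℤ) (Λ : Finset (Literature.MathematicalPhysics.QuantumLattice.ZdEdge 4)) (η : Literature.MathematicalPhysics.QuantumLattice.LGConfig 4 G) (e₁ e₂ : Literature.MathematicalPhysics.QuantumLattice.ZdEdge 4) (f g : Literature.MathematicalPhysics.QuantumLattice.LGConfig 4 G → ℝ), Λ = (((Fintype.piFinset fun j : Fin 4 => Finset.Icc (v j) (v j + M)) ×ˢ (Finset.univ : Finset (Fin 4))).filter fun e => e.1 e.2 + 1 ≤ v e.2 + M ∧ ∀ j, j ≠ e.2 → v j < e.1 j ∧ e.1 j < v j + M) → (∀ j, v j ≤ e₁.1 j ∧ e₁.1 j ≤ v j + M) → e₁.1 e₁.2 + 1 ≤ v e₁.2 + M → (∀ j, v j ≤ e₂.1 j ∧ e₂.1 j ≤ v j + M) → e₂.1 e₂.2 + 1 ≤ v e₂.2 + M → Measurable f → Measurable g → Literature.MathematicalPhysics.QuantumLattice.IsCylinder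 f ((Literature.MathematicalPhysics.QuantumLattice.plaquettesTouching {e₁}).biUnion Literature.MathematicalPhysics.QuantumLattice.plaquetteEdges) → Literature.MathematicalPhysics.QuantumLattice.IsCylinder g ((Literature.MathematicalPhysics.QuantumLattice.plaquettesTouching {e₂}).biUnion Literature.MathematicalPhysics.QuantumLattice.plaquetteEdges) → (∀ U, |f U| ≤ 1) → (∀ U, |g U| ≤ 1) → |(∫ U, f U * g U ∂(Literature.MathematicalPhysics.QuantumLattice.ymSpecification (d := 4) r.ρ (b k) Λ η)) - (∫ U, f U ∂(Literature.MathematicalPhysics.QuantumLattice.ymSpecification (d := 4) r.ρ (b k) Λ η)) * (∫ U, g U ∂(Literature.MathematicalPhysics.QuantumLattice.ymSpecification (d := 4) r.ρ (b k) Λ η))| ≤ 4 * Real.exp (-((m k) * ‖e₁.1 - e₂.1‖)))) → Filter.Tendsto m Filter.atTop (nhds 0)) → ∃ (sch : Literature.MathematicalPhysics.QuantumFieldTheory.SpeciesScheme (Literature.MathematicalPhysics.QuantumFieldTheory.YMSpecies G)) (T : Literature.MathematicalPhysics.QuantumFieldTheory.OSData (Literature.MathematicalPhysics.QuantumFieldTheory.YMSpecies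 G) 4), sch.HasWeakCouplingLimit ∧ Literature.MathematicalPhysics.QuantumFieldTheory.IsYangMillsFor r sch T ∧ T.IsNontrivial r.curvature ∧ T.IsNonGaussian r.curvature ∧ ∃ Δ > 0, T.HasMassGap Δ ∧ Literature.MathematicalPhysics.QuantumFieldTheory.HasLatticeMassGap r sch Δ

-- earlier StrongGapSeqAllG (stmt-QuantumFields-9021, replaced 2026-08-15T16:14:58Z -> stmt-QuantumFields-10417): retired by None — ∀ (G : Type) [Group G] [TopologicalSpace G] [IsTopologicalGroup G] [CompactSpace G], Literature.MathematicalPhysics.QuantumFieldTheory.IsCompactSimpleLieGroup G → letI : MeasurableSpace G := borel G; haveI : BorelSpace G := ⟨rfl⟩; ∃ r : Literature.MathematicalPhysics.Qua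
/-- item stmt-QuantumFields-10417 · crux · rank 6 · open · by planner
why it might fail: Boundary-UNIFORM decay at weak coupling may fail for every faithful r even if the torus gap holds: Chatterjee 2021 (after Def. 2.3) doubts the gap conjecture includes this strong version; adversarial boundary holonomies could order a boundary layer at large beta (bulk unique, half-space not).
sources: Chatterjee2021, arXiv:2006.16229, doi:10.1007/bf01018227, ChatterjeeYMProb2019, Borgs1988
[crux] STRONG LATTICE GAP ALONG A SEQUENCE, EVERY G (IR input L1 in strong-mixing form): every
compact simple Lie group G has a faithful unitary lattice representation r and couplings b_k → ∞
such that at each b_k Wilson's theory in r satisfies StrongExpDecay(r.ρ, b_k, 4, m_k) for some m_k ∈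
(0,1] (cubes of ℤ⁴, arbitrary boundary conditions, edge-local observables). A sequence, not all
couplings: bulk first-order points (SU(N ≥ 5) Wilson action) are allowed to be skipped. [difficulty:
open-problem] -/
@[route_item "route-QuantumFields-ThermalRuler", crux]
def StrongGapSeqAllG : Prop :=
  ∀ (G : Type) [Group G] [TopologicalSpace G] [IsTopologicalGroup G] [CompactSpace G], Literature.MathematicalPhysics.QuantumFieldTheory.IsCompactSimpleLieGroup G → letI : MeasurableSpace G := borel G; haveI : BorelSpace G := ⟨rfl⟩; ∃ r : Literature.MathematicalPhysics.QuantumFieldTheory.LatticeRep G, (∃ b m : ℕ → ℝ, Filter.Tendsto b Filter.atTop Filter.atTop ∧ ∀ k, 0 < m k ∧ m k ≤ 1 ∧ (∀ (M : ℕ) (v : Fin 4 → ℤ) (Λ : Finset (Literature.MathematicalPhysics.QuantumLattice.ZdEdge 4)) (η : Literature.MathematicalPhysics.QuantumLattice.LGConfig 4 G) (e₁ e₂ : Literature.MathematicalPhysics.QuantumLattice.ZdEdge 4) (f g : Literature.MathematicalPhysics.QuantumLattice.LGConfig 4 G → ℝ), Λ = (((Fintype.piFinset fun j : Fin 4 =>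 Finset.Icc (v j) (v j + M)) ×ˢ (Finset.univ : Finset (Fin 4))).filter fun e => e.1 e.2 + 1 ≤ v e.2 + M ∧ ∀ j, j ≠ e.2 → v j < e.1 j ∧ e.1 j < v j + M) → (∀ j, v j ≤ e₁.1 j ∧ e₁.1 j ≤ v j + M) → e₁.1 e₁.2 + 1 ≤ v e₁.2 + M → (∀ j, v j ≤ e₂.1 j ∧ e₂.1 j ≤ v j + M) → e₂.1 e₂.2 + 1 ≤ v e₂.2 + M → Measurable f → Measurable g → Literature.MathematicalPhysics.QuantumLattice.IsCylinder f ((Literature.MathematicalPhysics.QuantumLattice.plaquettesTouching {e₁}).biUnion Literature.MathematicalPhysics.QuantumLattice.plaquetteEdges) → Literature.MathematicalPhysics.QuantumLattice.IsCylinder g ((Literature.MathematicalPhysics.QuantumLattice.plaquettesTouching {e₂}).biUnion Literature.MathematicalPhysics.QuantumLattice.plaquetteEdges) → (∀ U, |f U| ≤ 1) → (∀ U, |g U| ≤ 1) → |(∫ U, f U * g U ∂(Literature.MathematicalPhysics.QuantumLattice.ymSpecification (d := 4) r.ρ (b k) Λ η)) - (∫ U, f U ∂(Literature.MathematicalPhysics.QuantumLattice.ymSpecification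 (d := 4) r.ρ (b k) Λ η)) * (∫ U, g U ∂(Literature.MathematicalPhysics.QuantumLattice.ymSpecification (d := 4) r.ρ (b k) Λ η))| ≤ 4 * Real.exp (-((m k) * ‖e₁.1 - e₂.1‖))))

-- earlier SofteningCentreBlind (stmt-QuantumFields-9022, replaced 2026-08-15T16:14:58Z -> stmt-QuantumFields-10418): retired by None — ∀ (G : Type) [Group G] [TopologicalSpace G] [IsTopologicalGroup G] [CompactSpace G], Literature.MathematicalPhysics.QuantumFieldTheory.IsCompactSimpleLieGroup G → letI : MeasurableSpace G := borel G; haveI : BorelSpace G := ⟨rfl⟩; ∀ r : Literature.MathematicalPhysics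
/-- item stmt-QuantumFields-10418 · crux · rank 7 · open · by planner
why it might fail: Open, no mechanism: centre-blind (G,r) have no thermal order parameter (SO(3): Polyakov/Wilson criteria fail already at strong coupling, arXiv:2605.16162), so m_k -> 0 must come from asymptotic freedom itself (Chatterjee Problem 5.1); false iff a faithful centre-blind theory keeps a lattice-unit gap
sources: arXiv:2605.16162, ChatterjeeYMProb2019, Chatterjee2021
[crux] SOFTENING WHERE THE RULER IS SILENT: for every compact simple Lie group G and faithful
unitary lattice representation r such that NO central element acts in r by a scalar ≠ 1 (centreless
G: G₂, F₄, E₈, all adjoint forms; Spin(4k), which has no faithful irreducible representation;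
reducible centre-mixing r), every sequence of strong-decay rates m_k ∈ (0,1] (K₁ = 4) along
couplings b_k → ∞ tends to 0 (the lattice strong mixing length diverges). For representations that
do see the centre this is the support item RulerSoftens (from the target); here no thermal order
parameter exists. [difficulty: open-problem] -/
@[route_item "route-QuantumFields-ThermalRuler", crux]
def SofteningCentreBlind : Prop :=
  ∀ (G : Type) [Group G] [TopologicalSpace G] [IsTopologicalGroup G] [CompactSpace G], Literature.MathematicalPhysics.QuantumFieldTheory.IsCompactSimpleLieGroup G → letI : MeasurableSpace G := borel G; haveI : BorelSpace G := ⟨rfl⟩; ∀ r : Literature.MathematicalPhysics.QuantumFieldTheory.LatticeRep G, (¬ ∃ (z : G) (ω : ℂ), (∀ g : G, z * g = g * z) ∧ ω ≠ 1 ∧ r.ρ z = ω • (1 : Matrix (Fin r.N) (Fin r.N) ℂ)) → (∀ (b m : ℕ → ℝ), Filter.Tendsto b Filter.atTop Filter.atTop → (∀ k, 0 < m k ∧ m k ≤ 1 ∧ (∀ (M : ℕ) (v : Fin 4 → ℤ) (Λ : Finset (Literature.MathematicalPhysics.QuantumLattice.ZdEdge 4)) (η : Literature.MathematicalPhysics.QuantumLattice.LGConfig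 4 G) (e₁ e₂ : Literature.MathematicalPhysics.QuantumLattice.ZdEdge 4) (f g : Literature.MathematicalPhysics.QuantumLattice.LGConfig 4 G → ℝ), Λ = (((Fintype.piFinset fun j : Fin 4 => Finset.Icc (v j) (v j + M)) ×ˢ (Finset.univ : Finset (Fin 4))).filter fun e => e.1 e.2 + 1 ≤ v e.2 + M ∧ ∀ j, j ≠ e.2 → v j < e.1 j ∧ e.1 j < v j + M) → (∀ j, v j ≤ e₁.1 j ∧ e₁.1 j ≤ v j + M) → e₁.1 e₁.2 + 1 ≤ v e₁.2 + M → (∀ j, v j ≤ e₂.1 j ∧ e₂.1 j ≤ v j + M) → e₂.1 e₂.2 + 1 ≤ v e₂.2 + M → Measurable f → Measurable g → Literature.MathematicalPhysics.QuantumLattice.IsCylinder f ((Literature.MathematicalPhysics.QuantumLattice.plaquettesTouching {e₁}).biUnion Literature.MathematicalPhysics.QuantumLattice.plaquetteEdges) → Literature.MathematicalPhysics.QuantumLattice.IsCylinder g ((Literature.MathematicalPhysics.QuantumLattice.plaquettesTouching {e₂}).biUnion Literature.MathematicalPhysics.QuantumLattice.plaquetteEdges) → (∀ U, |f U| ≤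 1) → (∀ U, |g U| ≤ 1) → |(∫ U, f U * g U ∂(Literature.MathematicalPhysics.QuantumLattice.ymSpecification (d := 4) r.ρ (b k) Λ η)) - (∫ U, f U ∂(Literature.MathematicalPhysics.QuantumLattice.ymSpecification (d := 4) r.ρ (b k) Λ η)) * (∫ U, g U ∂(Literature.MathematicalPhysics.QuantumLattice.ymSpecification (d := 4) r.ρ (b k) Λ η))| ≤ 4 * Real.exp (-((m k) * ‖e₁.1 - e₂.1‖)))) → Filter.Tendsto m Filter.atTop (nhds 0))

/-- item stmt-QuantumFields-11072 · support · rank 2 · closed · proved by Summit.QuantumFields.YangMills.Theorems.LinearDeconfinementWindow_proof @ ddd5cbf215a8 (prover) · by planner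
why it might fail: the printed proof embeds G in ℂ^(n²) via ρ (pp. 350–353) and is stated for U(N)/SU(N); a hidden L₀-dependence of the constants in (III.57)–(III.59) (digits illegible in the held scan) would make the window super-linear and shorten the ruler to log β.
sources: BorgsSeiler1983, FrohlichIsraelLiebSimon1978, FrohlichSimonSpencer1976, Literature.Barriers.QuantumFields.FiniteTemperatureDeconfinement
[support] BORGS–SEILER DECONFINEMENT WITH A LINEAR WINDOW (rev-3 position-side restatement of
ExplicitInfraredBound; BorgsSeiler1983 Thm III.7 p. 353, by inverting Lemma III.6's printed rate
f(J_E) = (1 + 2J_E⁻¹χ(1))^L₀ − 1, p. 348): for every compact second-countable G, every continuous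
unitary ρ : G → M_n(ℂ) with 0 < n and every space dimension d ≥ 3 there is C₀ = C₀(G, ρ, d) > 0 such
that for EVERY temporal extent L₀ ≥ 1 and all couplings J_E ≥ C₀·L₀, J_M > 0,
`FiniteTemperature.HasPolyakovLongRangeOrder d L₀ ρ J_E J_M` (Polyakov long-range order on ℤ^d×ℤ_L₀;
the ruler uses d = 3, J_E = J_M = β). Follows from the rev-2 Fourier-side form
(`HasPolyakovInfraredBound` with f(J) = A((1+A/J)^L₀ − 1)) by the PROVED
`FiniteTemperature.hasPolyakovLongRangeOrder_of_infraredBound` + `one_le_polyakovCorrelation_zero` +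
arithmetic (planner folder Equiv.lean, lean check rc 0), and implies the catalogued cone fact
`Literature.Barriers.QuantumFields.FiniteTemperatureDeconfinement` outright (Sketch.lean
`fact_of_window`) — needs-fact. Known result (retriage 2026-08-15: support, rank 2); an L-sized
formalisation of BS83 §III.2. [difficulty: L] -/
@[route_item "route-QuantumFields-ThermalRuler"]
def LinearDeconfinementWindow : Prop :=
  ∀ (G : Type) [Group G] [TopologicalSpace G] [IsTopologicalGroup G] [CompactSpace G] [SecondCountableTopology G] [MeasurableSpace G] [BorelSpace G] (n d : ℕ) (ρ : G →* Matrix (Fin n) (Fin n) ℂ), Continuous ρ → (∀ g, ρ g ∈ Matrix.unitaryGroup (Fin n) ℂ) → 0 < n → 3 ≤ d → ∃ C₀ : ℝ, 0 < C₀ ∧ ∀ (L₀ : ℕ) [NeZero L₀] (JE JM : ℝ), C₀ * L₀ ≤ JE → 0 < JM → Literature.Barriers.QuantumFields.FiniteTemperature.HasPolyakovLongRangeOrder d L₀ ρ JE JM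

-- earlier RulerSoftens (stmt-QuantumFields-9024, replaced 2026-08-15T16:14:58Z -> stmt-QuantumFields-10419): retired by None — ThermalRulerBound → ∀ (G : Type) [Group G] [TopologicalSpace G] [IsTopologicalGroup G] [CompactSpace G], Literature.MathematicalPhysics.QuantumFieldTheory.IsCompactSimpleLieGroup G → letI : MeasurableSpace G := borel G; haveI : BorelSpace G := ⟨rfl⟩; ∀ (r : Literature.Mathem
/-- item stmt-QuantumFields-10419 · support · rank 9 · closed · proved by Summit.QuantumFields.YangMills.Theorems.ThermalRuler.rulerSoftens_proof (prover) · by planner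
sources: Chatterjee2021, BorgsSeiler1983
[support] GLUE (real analysis, provable now): ThermalRulerBound → for every compact simple Lie G
(borel σ-algebra), every faithful r : LatticeRep G and central z with r.ρ z = ω•1, ω ≠ 1, every
sequence b_k → ∞ with strong-decay rates m_k ∈ (0,1] (K₁ = 4) has m_k → 0. Proof: `ConnectedSpace G`
from `IsSimpleCompactGroup`, second countability from the closed embedding r.ρ, 0 < r.N since G is
non-abelian; then m_k⁴ b_k ≤ C log(4b_k/m_k)^a eventually, and m_k ≥ ε frequently would give ε⁴b_k ≤
C log(4b_k/ε)^a along b_k → ∞, absurd. [difficulty: provable-now] -/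
@[route_item "route-QuantumFields-ThermalRuler", crux]
def RulerSoftens : Prop :=
  ThermalRulerBound → ∀ (G : Type) [Group G] [TopologicalSpace G] [IsTopologicalGroup G] [CompactSpace G], Literature.MathematicalPhysics.QuantumFieldTheory.IsCompactSimpleLieGroup G → letI : MeasurableSpace G := borel G; haveI : BorelSpace G := ⟨rfl⟩; ∀ (r : Literature.MathematicalPhysics.QuantumFieldTheory.LatticeRep G) (z : G) (ω : ℂ), (∀ g : G, z * g = g * z) → ω ≠ 1 → r.ρ z = ω • (1 : Matrix (Fin r.N) (Fin r.N) ℂ) → (∀ (b m : ℕ → ℝ), Filter.Tendsto b Filter.atTop Filter.atTop → (∀ k, 0 < m k ∧ m k ≤ 1 ∧ (∀ (M : ℕ) (v : Fin 4 → ℤ) (Λ : Finset (Literature.MathematicalPhysics.QuantumLattice.ZdEdge 4)) (η : Literature.MathematicalPhysics.QuantumLattice.LGConfig 4 G) (e₁ e₂ : Literature.MathematicalPhysics.QuantumLattice.ZdEdge 4) (f g : Literature.MathematicalPhysics.QuantumLattice.LGConfig 4 G → ℝ), Λ = (((Fintype.piFinset fun j : Fin 4 => Finset.Icc (v j) (v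 j + M)) ×ˢ (Finset.univ : Finset (Fin 4))).filter fun e => e.1 e.2 + 1 ≤ v e.2 + M ∧ ∀ j, j ≠ e.2 → v j < e.1 j ∧ e.1 j < v j + M) → (∀ j, v j ≤ e₁.1 j ∧ e₁.1 j ≤ v j + M) → e₁.1 e₁.2 + 1 ≤ v e₁.2 + M → (∀ j, v j ≤ e₂.1 j ∧ e₂.1 j ≤ v j + M) → e₂.1 e₂.2 + 1 ≤ v e₂.2 + M → Measurable f → Measurable g → Literature.MathematicalPhysics.QuantumLattice.IsCylinder f ((Literature.MathematicalPhysics.QuantumLattice.plaquettesTouching {e₁}).biUnion Literature.MathematicalPhysics.QuantumLattice.plaquetteEdges) → Literature.MathematicalPhysics.QuantumLattice.IsCylinder g ((Literature.MathematicalPhysics.QuantumLattice.plaquettesTouching {e₂}).biUnion Literature.MathematicalPhysics.QuantumLattice.plaquetteEdges) → (∀ U, |f U| ≤ 1) → (∀ U, |g U| ≤ 1) → |(∫ U, f U * g U ∂(Literature.MathematicalPhysics.QuantumLattice.ymSpecification (d := 4) r.ρ (b k) Λ η)) - (∫ U, f U ∂(Literature.MathematicalPhysics.QuantumLattice.ymSpecification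 (d := 4) r.ρ (b k) Λ η)) * (∫ U, g U ∂(Literature.MathematicalPhysics.QuantumLattice.ymSpecification (d := 4) r.ρ (b k) Λ η))| ≤ 4 * Real.exp (-((m k) * ‖e₁.1 - e₂.1‖)))) → Filter.Tendsto m Filter.atTop (nhds 0))

-- earlier RulerFromCruxes (stmt-QuantumFields-9023, replaced 2026-08-15T16:48:42Z -> stmt-QuantumFields-11073): retired by None — ExplicitInfraredBound → QuantCentreRestoration → ThermalRulerBound
/-- item stmt-QuantumFields-11073 · support · rank 9 · closed · proved by Summit.QuantumFields.YangMills.Theorems.rulerFromCruxes_proof (prover) · by planner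
sources: BorgsSeiler1983, Chatterjee2021
[support] GLUE (card P1's arithmetic half, provable now; rev 3: pure arithmetic):
LinearDeconfinementWindow → QuantCentreRestoration → ThermalRulerBound. Item 2 at d = 3 gives C₀ =
C₀(G, ρ) with Polyakov LRO at (3, L₀, ρ, β, β) whenever β ≥ C₀·L₀; given β ≥ max(2, 2C₀) put L₀ :=
⌊β/C₀⌋ ≥ 1 (C₀L₀ ≤ β): crux 3 forbids A·log(βK₁/K₂)^a ≤ K₂⁴L₀, so K₂⁴β < K₂⁴·2C₀L₀ <
2C₀·A·log(βK₁/K₂)^a; for 2 ≤ β < 2C₀ use K₂ ≤ 1 and log(βK₁/K₂) ≥ log 4 > 1. [difficulty: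
provable-now] -/
@[route_item "route-QuantumFields-ThermalRuler"]
def RulerFromCruxes : Prop :=
  LinearDeconfinementWindow → QuantCentreRestoration → ThermalRulerBound

/-- item stmt-QuantumFields-9025 · assembly · rank 1 · closed · proved by Summit.QuantumFields.YangMills.Theorems.thermalRuler_assembly_proof (prover) · by planner
sources: JaffeWitten2000, BorgsSeiler1983, Chatterjee2021
[assembly] ThermalRulerBound → RulerSoftens → SofteningCentreBlind → StrongGapSeqAllG →
ContinuumFromMixing → YangMills (StrongGapSeqAllG supplies (r, b, m); softening of m from
RulerSoftens or SofteningCentreBlind by cases; ContinuumFromMixing concludes). -/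
@[route_item "route-QuantumFields-ThermalRuler"]
def Assembly : Prop :=
  ThermalRulerBound → RulerSoftens → SofteningCentreBlind → StrongGapSeqAllG → ContinuumFromMixing → YangMills

-- records of items no longer active in this route (dropped / restated):
-- earlier ExplicitInfraredBound (stmt-QuantumFields-9017, replaced 2026-08-15T16:48:42Z -> stmt-QuantumFields-11072): retired by None — ∀ (G : Type) [Group G] [TopologicalSpace G] [IsTopologicalGroup G] [CompactSpace G] [SecondCountableTopology G] [MeasurableSpace G] [BorelSpace G] (n d : ℕ) (ρ : G →* Matrix (Fin n) (Fin n) ℂ), Continuous ρ → (∀ g, ρ g ∈ Matrix.unitaryGroup (Fin n) ℂ) → ∃ A : ℝ, 0 <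

/-! D-0027 §2.1 — DECIDING THEOREM (planner-authored via `route open/edit --closes-file`; by planner-rrepair-QuantumFields-ThermalRuler-stm-9e1d6168-0 2026-08-16T17:42:00Z):
its hypotheses are this route's items and its conclusion the sub-problem Statement (glue_lint), and it elaborates with this file. -/

@[closes "route-QuantumFields-ThermalRuler"] theorem closes : ThermalRulerBound → RulerSoftens → SofteningCentreBlind → StrongGapSeqAllG → ContinuumFromMixing → YangMills := by
  intro hR hRS hSCB hSG hC G _ _ _ _ hG
  obtain ⟨r, b, m, hb, hval⟩ := hSG G hG
  by_cases h : ∃ (z : G) (ω : ℂ), (∀ g : G, z * g = g * z) ∧ ω ≠ 1 ∧ r.ρ z = ω • (1 : Matrix (Fin r.N) (Fin r.N) ℂ)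
  · obtain ⟨z, ω, hz, hω, hρz⟩ := h
    exact ⟨r, hC G hG r b hb ⟨m, hval⟩ fun m' hm' => hRS hR G hG r z ω hz hω hρz b m' hb hm'⟩
  · exact ⟨r, hC G hG r b hb ⟨m, hval⟩ fun m' hm' => hSCB G hG r h b m' hb hm'⟩

end Summit.QuantumFields.YangMills.Theses.ThermalRuler
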